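import Mathlib
import Literature.NumberTheory.EllipticCurves.BurungaleCastellaSkinner2025.BDPMainConjectureRationalAtTrivialCharacter
import Literature.NumberTheory.EllipticCurves.PAdicGrossZagierConstantTermProofs
import HarnessLib

/-!
# CastellaWan2024BDPDivisibilityAtTrivialCharacter

Topic `Literature/NumberTheory/EllipticCurves`. Named literature fact(s) relocated by the gate from `Summits/BirchSwinnertonDyer/BirchSwinnertonDyer/Theorems/PrintX6AnticyclotomicCW53Composite.lean`
(accept-time relocation of `[cite]`d propositions written inline in a Summits proposal; human ruling 2026-08-15).
Sources: Castella2018, CastellaHsieh2018, CastellaLiuWan2022, CastellaWan2023.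

* `Literature.NumberTheory.EllipticCurves.castellaWan2024_thm53_castella2018_thm32_constantCoeff`
-/

namespace Literature.NumberTheory.EllipticCurves

open scoped Classical
open WeierstrassCurve NumberField IsDedekindDomain Field Literature.NumberTheory.EllipticCurves

/-- **Castella–Wan, *Perrin-Riou's main conj[.] for elliptic curves at supersingular primes* (title abbreviated in one bracketed word), Math.
Ann. 389 (2024) 2595–2636, Theorem 5.3 (the divisibility "`char_{Λac}(X^{rel,str}) Λ^ur ⊂ (L_p^BDP)`",
INTEGRAL at `N⁻ = 1`), COMBINED AT THE TRIVIAL CHARACTER with Castella, Camb. J. Math. 6 (2018) Theorem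
3.2 (the `p`-adic Waldspurger formula `L_p(f, 𝟙) = (1 − a_p p⁻¹ + p⁻¹)² · (log_{ω_E} P_K)²` up to a
`p`-adic unit, case `p ∤ N`).** Read on the authors' accepted manuscript of Castella–Wan (UCSB,
`Perrin-Riou.pdf`, 39 pp., the JOURNAL text; materialised `paper:url-7157bd4f7b88`) and on
arXiv:1704.06608 (Castella 2018). VERBATIM. CW §2 (MS p. 5 L27–L37): "we let `E/ℚ` be an elliptic
curve of conductor `N`, … and let `p ≥ 5` be a prime of good reduction for `E`. Let `K` be an
imaginary quadratic field … Writing `N = N⁺N⁻` with `N⁺` the largest factor of `N` divisible only by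
primes which are split or ramified in `K`, we assume that `K` satisfies the following generalized
Heegner hypothesis: (gen-H) `N⁻` is the squarefree product of an even number of primes, … In addition,
we assume that (spl) `(p) = 𝔭𝔭̄` splits in `K`, with `𝔭` be the prime `K` above `p` induced by `ι_p`."
CW §5 (MS p. 23, "Keeping the setting from Section 2"), Def. 5.1 (MS p. 23 L30–L37):
"`Sel^{rel,str}(K, A^ac)` consists of classes which are trivial at `𝔭̄` and satisfy no condition at
`𝔭`" (at `v ∤ p` the condition is the orthogonal complement of `H¹(K_v, T^ac)`, MS p. 22 L16–L39),
`X^{rel,str}` its Pontryagin dual; (2.2) (MS p. 8): `L_p^BDP := (𝓛_p^BDP)²`; **Theorem 5.3** (MS p. 23 L62 – p. 24 L2): "([CLW22]). Assume that: (i) `N` is squarefree,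
(ii) some prime `ℓ ∣ N` is non-split in `K`, (iii) if `N` is odd, then `2` splits in `K`. Then
`char_{Λac}(X^{rel,str}) Λ^ur ⊂ (L_p^BDP)` in `Λ^ur[1/p]`. If in addition `E[p]` is ramified at every
prime `ℓ ∣ N⁻`, then the divisibility holds in `Λ^ur`." (Proof, MS p. 24: [CLW22, Thm. 8.2.1 (1)] +
[SU14, Prop. 3.9] + Prop. 2.7.) Cas18 Thm. 3.2 (arXiv:1704.06608 p. 9; §2.1 p. 5: `E/ℚ` semistable,
`p ≥ 5`, `ρ̄_{E,p}` irreducible, `K` imaginary quadratic with `p = 𝔭𝔭̄` split; §3 (Heeg): every prime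
factor of `N` split or ramified in `K`; (3.2) `π^*(ω_E) = c·ω_f`, `c ∈ ℤ_{(p)}^×`): "The following
equality holds up to a `p`-adic unit: `L_p(f, 𝟙) = (1 − a_p p⁻¹ + ε_p)² · (log_{ω_E} P_K)²`, where
`ε_p = p⁻¹` if `p ∤ N`" — tree fact `Castella2018.thm32_exists_isBDPLFunction_valueAtOne` (A207).
HERE: the case `N⁻ = 1` of (gen-H) (every `ℓ ∣ N` split or ramified, the integrality clause of
Thm. 5.3 being VACUOUS), composed at `𝟙`: for a generator `F` of `char_Λ` of the dual Selmer module
(strict at `𝔭̄`, relaxed at `𝔭`), `F = L_p^BDP · h` with `h ∈ Λ^ur`, so `F(0) = L_p^BDP(𝟙)·h(0) =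
e · ((1 − a_p p⁻¹ + p⁻¹)·log_{ω_E} P_K)²` with `e = u·h(0) ∈ ℚ_p ∩ ℤ_p^ur = ℤ_p`. TRANSCRIBED in the
letters of the tree's `BurungaleCastellaSkinner2025.thm124a_prop422_thm513_generator_constantCoeff`
(the accepted ORDINARY composite of the same shape, p533331): `W` globally minimal, `5 ≤ p`,
`Good W p`, `Semistable W` ((i)), `Irr W p` (Cas18 §2.1); `K` imaginary quadratic with (gen-H at
`N⁻ = 1`) = Cas18 (Heeg) in the residue-degree-one form of A206/A207 (`∀ ℓ ∣ N, ∃ v, absNorm v = ℓ`),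
(ii) `∃ ℓ ∣ N` with `((ℓ).primesOver 𝓞K).ncard ≠ 2`, (iii) `¬ 2 ∣ N → ((2).primesOver 𝓞K).ncard = 2`,
(spl) `SatisfiesHeegnerHypothesis p K`; `ι : K →+* ℚ_p` inducing `v` (`x ∈ v ↔ ‖ι x‖ < 1`), `vbar ∋ p`,
`vbar ≠ v` the STRICT prime; `κ` anticyclotomic with generator `γ`;
`X^{rel,str} = AcSelmer.XAc (W.baseChange K) p κ vbar ∅ γ` (Cas18 Def. 2.2's module: strict at `vbar`,
relaxed at `v`, unramified at `w ∤ p`; CW's Selmer condition at `w ∤ p` is CONTAINED in it, so CW's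
dual is a quotient and the divisibility transfers — reading flag `CW24-53-XrelstrReading`); `Dt` a
parametrisation datum with `p ∤ Dt.c` ((3.2)), `P` the Heegner point of `(Dt, H)` read through
`ιC : K ↪ ℂ`, `log_{ω_E} P_K = log_W(z(m₀ • P_ι))/m₀` as there. Conclusion: for every `F` with
`ch_Λ(X) = (F)` there is `e : ℤ_p` with `F(0) = e · ((1 − a_p p⁻¹ + p⁻¹) · log_{ω_E}(P_K))²` in `ℚ_p`.
NO `Λ`-torsion clause (Thm. 5.3 asserts none). COMPOSITE OF TWO PRINTED, PUBLISHED THEOREMS (flags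
offered, travel with the fact: `CW24-53+Cas18-32-composite`; `CW24-Cas18-LBDP-identification@CH18` —
CW Prop. 2.1 proof, MS p. 6 L36–L40: "the construction of `𝓛_p^BDP` can be found in [BCK21, §4],
where it is deduced from an extension of the construction in [CH18]", Cas18 proof of Thm. 3.1:
"`L_p(f) := Tw_{ψ⁻¹}(ℒ_{𝔭,ψ}(f))` with `ℒ_{𝔭,ψ}(f)` the `p`-adic `L`-function of [CH18, Def. 3.5]" —
the two squares of the CH18 function are read as equal up to a unit of `Λ^ur`; inherited:
`CW24-CLW22-addendum`, `Hid04-gap`, `Cas18-Thm32-parametrisation-via-(3.2)`). Supersingularity is NOT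
a hypothesis of either theorem (CW §5 keeps the §2 setting: `p ≥ 5` good). Nothing asserted.
[cite: CastellaWan2023, Thm. 5.3 (MS p. 23 L62–p. 24 L2) with §2 (MS p. 5 L27–L37), Def. 5.1 (p. 23), (2.2) (p. 8), Prop. 2.1 (p. 6)]
[cite: Castella2018, Thm. 3.2 with (3.2) and Thm. 3.1 (arXiv:1704.06608 p. 9), §2.1–2.2 (p. 5)]
[cite: CastellaLiuWan2022, Thm. 8.2.1 (1) (the source of Thm. 5.3)] [cite: CastellaHsieh2018, Def. 3.5 (the common construction)]
[file NumberTheory/EllipticCurves/CastellaWan2024BDPDivisibilityAtTrivialCharacter] -/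
def castellaWan2024_thm53_castella2018_thm32_constantCoeff : Prop :=
  ∀ (W : WeierstrassCurve ℚ) [W.IsElliptic] [W.IsGloballyMinimal] (p : ℕ) [Fact p.Prime],
    5 ≤ p → Literature.NumberTheory.EllipticCurves.Rank1Residual.Good W p →
    Literature.NumberTheory.EllipticCurves.Rank1Residual.Semistable W →
    Literature.NumberTheory.EllipticCurves.Rank1Residual.Irr W p →
    ∀ (K : Type) [Field K] [NumberField K],
      Literature.NumberTheory.EllipticCurves.IsImaginaryQuadratic K →
      (∀ ℓ : ℕ, ℓ.Prime → ℓ ∣ W.conductorNorm ℤ →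
        ∃ v : IsDedekindDomain.HeightOneSpectrum (𝓞 K), Ideal.absNorm v.asIdeal = ℓ) →
      (∃ ℓ : ℕ, ℓ.Prime ∧ ℓ ∣ W.conductorNorm ℤ ∧
        ((Ideal.span {(ℓ : ℤ)}).primesOver (𝓞 K)).ncard ≠ 2) →
      (¬ 2 ∣ W.conductorNorm ℤ → ((Ideal.span {(2 : ℤ)}).primesOver (𝓞 K)).ncard = 2) →
      Literature.NumberTheory.EllipticCurves.SatisfiesHeegnerHypothesis p K →
    ∀ (ι : K →+* ℚ_[p]) (v vbar : IsDedekindDomain.HeightOneSpectrum (𝓞 K)),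
      (∀ x : 𝓞 K, x ∈ v.asIdeal ↔ ‖ι (x : K)‖ < 1) →
      ((p : ℕ) : 𝓞 K) ∈ vbar.asIdeal → vbar ≠ v →
    ∀ (κ : Literature.NumberTheory.EllipticCurves.ZpExtension K p), κ.IsAnticyclotomic →
    ∀ (γ : Field.absoluteGaloisGroup K) [Fact (κ.IsTopGenerator γ)],
    ∀ (N : ℕ) [NeZero N] (Dt : Literature.NumberTheory.EllipticCurves.ModularForms.ModularParametrizationData W N)
      (H : Literature.NumberTheory.EllipticCurves.HeegnerDatum N (NumberField.discr K)) (ιC : K →+* ℂ)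
      (P : (W.baseChange K).toAffine.Point),
      ¬ (p : ℤ) ∣ Dt.c →
      WeierstrassCurve.Affine.Point.map ιC.toRatAlgHom P =
        Literature.NumberTheory.EllipticCurves.ModularForms.heegnerPointComplex Dt H →
    ∀ F : Literature.NumberTheory.EllipticCurves.IwasawaAlgebra p,
      Literature.NumberTheory.EllipticCurves.Castella2018.AcSelmer.XAc.charIdeal (W.baseChange K) p
          κ vbar ∅ γ = Ideal.span {F} →
      ∃ e : ℤ_[p],
        ((PowerSeries.constantCoeff F : ℤ_[p]) : ℚ_[p]) =
          (e : ℚ_[p]) *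
            ((1 - (W.frobeniusTrace p : ℚ_[p]) * (p : ℚ_[p])⁻¹ + (p : ℚ_[p])⁻¹) *
              ((W.baseChange ℚ_[p]).padicLogPoint
                  (Literature.NumberTheory.EllipticCurves.formalIndex W p •
                    Literature.NumberTheory.EllipticCurves.padicPointOf W p ι P) /
                (Literature.NumberTheory.EllipticCurves.formalIndex W p : ℚ_[p]))) ^ 2

/-! ### §2 Consumers (PROVED): the composite at the trivial character in valuations -/

end Literature.NumberTheory.EllipticCurves
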